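import Literature.AnabelianGeometry.AbsoluteAnabelian.AbsTopIII.ReconstructionCor110iaNatural
import Literature.AnabelianGeometry.AbsoluteAnabelian.AbsTopIII.ReconstructionCor110NatResidue
import Literature.AnabelianGeometry.AbsoluteAnabelian.GaloisCyclotomeTransportNaturality
import Literature.AnabelianGeometry.AbsoluteAnabelian.AbsAnabUnitsTransportHolds
import Literature.AnabelianGeometry.AbsoluteAnabelian.AbsTopIII.ReconstructionCor110KummerImageChart
import HarnessLib

/-!
# [AbsTopIII] Cor. 1.10 (i)(a) natural form — `AbsTopIII.cor_1_10_i_a_natural_holds` (the isomorphism case)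

Mochizuki, *Topics in Absolute Anabelian Geometry III*, Cor. 1.10 (i)(a) p. 42: «one constructs the natural
isomorphism `H²(G_k, μ_Ẑ(G_k)) ⥲ Ẑ` "group-theoretically" from `G_k` via the algorithm described in the proof of
[Mzk9], Proposition 1.2.1, (vii)».  PROOF-ONLY companion (abc-iut layer L4, row «COR110ia-NAT», abc-iut-L4-d1) of
`ReconstructionCor110iaNatural.lean`: the statement `AbsTopIII.Cor_1_10_i_a_natural` (ONE family
`r_k : H²(G_k, μ_Ẑ(G_k)) ≃+ Ẑ`, levelwise THE invariant maps, invariant under EVERY isomorphism of topological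
groups `α : G_{k₁} ≃ₜ* G_{k₂}`) is PROVED.

THE FAMILY: `r_k := H²(i_k) ≫ (H²(G_k, Ẑ(1)) ≃ lim_n H²(G_k, μ_n)) ≫ (lim_n H²(G_k, μ_n) ≃ Ẑ)` with
`i_k = galCyclotomeIsoTateModule k D_k.equiv _` for THE characterised torsion reciprocity datum `D_k`
(`exists_torsionReciprocityData_levelChar`, abc-iut-L6-t11) and the last two isomorphisms abc-iut-L4-t11's
(`continuousCohomologyTwoTateModuleEquiv`, `cohomologyLimitMuEquivZHat` — levelwise THE `invMap`).
Clause (1) is abc-iut-L4-d3's `Cor110Nat.level_residueZHat`; clause (2) is abc-iut-L4-d3's ENGINE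
`Cor110Nat.residueZHat_transport` (`ReconstructionCor110NatResidue.lean`; [AbsAnab] Prop. 1.2.1 (vii) «`α`
preserves the residue map» levelwise, `galoisMLF_iso_residueMap_holds`, abc-iut-w5-d198) fed with THE units
transport of `α` (`Prop121vii.unitsTransport_holds`, abc-iut-L4-d3) and the compatibility of `D_{k₁}, D_{k₂}`
under it (abc-iut-L6-t11's `theta_transport_of_levelChar` / `toMul_muLift_map_of_level`).  CHART INDEPENDENCE
(`residueIso_chart_independent`): for an ABSTRACT topological group `G` and any two charts
`ι_j : G ≃ₜ* G_{k_j}`, the residue of `x ∈ H²(G, μ_Ẑ(G))` read through `ι₁` or `ι₂` is the same element of `Ẑ`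
(functoriality `galCyclotomeH2Map_trans` + clause (2)) — the p. 42 isomorphism is literally a function of the
topological group (Rmk. 1.9.8).  The named pieces `Cor110iaNat.datum` / `iso` / `residueIso` are definitions
(so that abc-iut-L4-d3's index-clause closer of `Cor_1_10_i_a_resNatural`, Rmk. 1.10.1 (iii), uses the SAME
family); everything else is a theorem.  HONEST FRAMING: classical
local class field theory; nothing here bears on [IUTchIII] Cor. 3.12 or takes a side.
-/

noncomputable section

open CategoryTheory Function
open Field ValuativeRel
open ProfiniteGrp ProfiniteGrp.ProfiniteCompletion

namespace Literature.AnabelianGeometry.AbsoluteAnabelian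

open _root_.TopRep _root_.ContRepresentation _root_.ContinuousCohomology
open Literature.NumberTheory.GaloisRepresentations
open Literature.NumberTheory.GaloisRepresentations.DiscreteGaloisModule
open Literature.AnabelianGeometry.EtaleTheta Literature.AnabelianGeometry.EtaleTheta.ZHatLevel

namespace AbsTopIII

/-- The index form implies the natural form (drop clause (3)). [cite: MochizukiAbsTopIII2015, Cor 1.10 (i) p.42] -/
theorem cor_1_10_i_a_natural_of_resNatural (h : Cor_1_10_i_a_resNatural) : Cor_1_10_i_a_natural := by
  obtain ⟨r, h₁, h₂, -⟩ := h
  exact ⟨r, h₁, h₂⟩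

end AbsTopIII

namespace Cor110iaNat

section Family

variable (k : Type) [Field k] [ValuativeRel k] [TopologicalSpace k] [IsNonarchimedeanLocalField k] [CharZero k]

/-- THE characterised torsion reciprocity datum `D_k` of `k` (abc-iut-L6-t11's
`exists_torsionReciprocityData_levelChar`; the same choice as abc-iut-L4-d3's `Cor110Nat.exists_family_components`).
[cite: MochizukiAbsAnab2004, Prop 1.2.1 (vi) p.10] -/
def datum : TorsionReciprocityData k := Classical.choose (exists_torsionReciprocityData_levelChar k)

/-- `i_k : μ_Ẑ(G_k) ≅ Ẑ(1)(k̄)` in `TopRep` for THE canonical identification `D_k.equiv` (abc-iut-L4-t11's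
`galCyclotomeIsoTateModule`). [cite: MochizukiAbsTopIII2015, Cor 1.10 (i) p.42] -/
def iso : galCyclotomeTopRep (absoluteGaloisGroup k) ≅ (tateModuleMu k).toTopRep :=
  galCyclotomeIsoTateModule k (datum k).equiv (datum k).equiv_smul

/-- **THE residue isomorphism `r_k : H²(G_k, μ_Ẑ(G_k)) ≃+ Ẑ`**: `H²(i_k)`, then abc-iut-L4-t11's
`H²(G_k, Ẑ(1)) ≃ lim_n H²(G_k, μ_n) ≃ Ẑ` (levelwise THE invariant maps). [cite: MochizukiAbsTopIII2015, Cor 1.10 (i) p.42] -/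
def residueIso :
    galCyclotomeH2 (absoluteGaloisGroup k) ≃+ Additive (completion (GrpCat.of (Multiplicative ℤ))) :=
  ((AddEquiv.mk' (continuousCohomologyEquivOfIso (iso k) 2)
      fun x y => map_add (cohomologyMap (iso k).hom 2).hom x y).trans
    (continuousCohomologyTwoTateModuleEquiv k)).trans (cohomologyLimitMuEquivZHat k)

/-- Unfolding `residueIso`. [cite: MochizukiAbsTopIII2015, Cor 1.10 (i) p.42] -/
theorem residueIso_apply (x : galCyclotomeH2 (absoluteGaloisGroup k)) :
    residueIso k x = cohomologyLimitMuEquivZHat k (continuousCohomologyTwoTateModuleEquiv k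
      ((cohomologyMap (iso k).hom 2).hom x)) :=
  rfl

/-- (1): `r_k` IS the residue map, levelwise (abc-iut-L4-d3's `Cor110Nat.level_residueZHat`).
[cite: MochizukiAbsTopIII2015, Cor 1.10 (i) p.42] -/
theorem level_residueIso (x : galCyclotomeH2 (absoluteGaloisGroup k)) (n : ℕ+) :
    Multiplicative.toAdd (level n (Additive.toMul (residueIso k x))) =
      invMap k n (cohomologyMap ((muSystem k).projHom n) 2 ((cohomologyMap (iso k).hom 2).hom x)) := by
  rw [residueIso_apply]
  exact Cor110Nat.level_residueZHat k _ n

end Family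

section Natural

variable {k₁ k₂ : Type} [Field k₁] [ValuativeRel k₁] [TopologicalSpace k₁]
  [IsNonarchimedeanLocalField k₁] [CharZero k₁] [Field k₂] [ValuativeRel k₂] [TopologicalSpace k₂]
  [IsNonarchimedeanLocalField k₂] [CharZero k₂]

/-- (2): **`r_{k₂} ∘ H²(α; μ_Ẑ(α)) = r_{k₁}`** for every `α : G_{k₁} ≃ₜ* G_{k₂}` — abc-iut-L4-d3's engine
`Cor110Nat.residueZHat_transport` fed with THE units transport of `α` and the transport of the characterised data.
[cite: MochizukiAbsAnab2004, Prop 1.2.1 (vii) p.11] -/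
theorem residueIso_natural (α : absoluteGaloisGroup k₁ ≃ₜ* absoluteGaloisGroup k₂)
    (x : galCyclotomeH2 (absoluteGaloisGroup k₁)) :
    residueIso k₂ (galCyclotomeCohomologyMap α 2 x) = residueIso k₁ x := by
  obtain ⟨ψ, hψ, hA, hU⟩ := Prop121vii.unitsTransport_holds k₁ k₂ α
  have hμ : ∀ z : muQZ (absoluteGaloisGroup k₁),
      Additive.toMul ((datum k₂).muLift (muQZ.map α z)) = ψ (Additive.toMul ((datum k₁).muLift z)) := fun z =>
    TorsionReciprocityData.toMul_muLift_map_of_level (datum k₁) (datum k₂) α ψ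
      (fun U x => TorsionReciprocityData.theta_transport_of_levelChar
        (Classical.choose_spec (exists_torsionReciprocityData_levelChar k₁))
        (Classical.choose_spec (exists_torsionReciprocityData_levelChar k₂)) hψ hU U x) z
  obtain ⟨c, rfl⟩ := twoCocycleClass_surjective _ x
  rw [residueIso_apply, residueIso_apply]
  exact Cor110Nat.residueZHat_transport (datum k₁) (datum k₂) α hψ hA hU hμ c

end Natural

end Cor110iaNat

namespace AbsTopIII

/-- **[AbsTopIII] Cor. 1.10 (i)(a), NATURAL form — PROVED (isomorphism case).**  THE family
`r_k := H²(i_k) ≫ (H²(G_k, Ẑ(1)) ≃ lim_n H²(G_k, μ_n) ≃ Ẑ)` (`Cor110iaNat.residueIso`) built on THE characterised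
torsion reciprocity datum of each MLF `k` is (1) levelwise THE invariant map of local class field theory and (2)
INVARIANT under every isomorphism of topological groups `α : G_{k₁} ≃ₜ* G_{k₂}`: the residue
`H²(G_k, μ_Ẑ(G_k)) ⥲ Ẑ` «constructed "group-theoretically"» is an invariant of the profinite group.
[cite: MochizukiAbsTopIII2015, Cor 1.10 (i) p.42] -/
theorem cor_1_10_i_a_natural_holds : Cor_1_10_i_a_natural :=
  ⟨fun k _ _ _ _ _ => Cor110iaNat.residueIso k,
    fun k _ _ _ _ _ => ⟨(Cor110iaNat.datum k).equiv, (Cor110iaNat.datum k).equiv_smul,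
      fun x n => Cor110iaNat.level_residueIso k x n⟩,
    fun _ _ _ _ _ _ _ _ _ _ _ _ α x => Cor110iaNat.residueIso_natural α x⟩

end AbsTopIII

namespace Cor110iaNat

/-! ### Functoriality of `H²(α; μ_Ẑ(α))` along isomorphisms -/

section Trans

universe u

variable {G : Type u} [Group G] [TopologicalSpace G] [IsTopologicalGroup G] [CompactSpace G]
  {G' : Type u} [Group G'] [TopologicalSpace G'] [IsTopologicalGroup G'] [CompactSpace G']
  {G'' : Type u} [Group G''] [TopologicalSpace G''] [IsTopologicalGroup G''] [CompactSpace G'']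

/-- **`H²(β ∘ α; μ_Ẑ) = H²(β; μ_Ẑ) ∘ H²(α; μ_Ẑ)`**: the transport of `H²` of the group-theoretic cyclotome along
isomorphisms of topological groups is functorial (on explicit continuous `2`-cocycles, via
`Cor110iiPrime.congrL_trans`). [cite: MochizukiAbsTopIII2015, Cor 1.10 (i) p.42] -/
theorem galCyclotomeH2Map_trans (α : G ≃ₜ* G') (β : G' ≃ₜ* G'') (x : galCyclotomeH2 G) :
    galCyclotomeCohomologyMap (α.trans β) 2 x =
      galCyclotomeCohomologyMap β 2 (galCyclotomeCohomologyMap α 2 x) := by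
  obtain ⟨c, rfl⟩ := twoCocycleClass_surjective _ x
  rw [show galCyclotomeCohomologyMap (α.trans β) 2 (twoCocycleClass _ c) = _ from map_twoCocycleClass _ _ _ c,
    show galCyclotomeCohomologyMap α 2 (twoCocycleClass _ c) = _ from map_twoCocycleClass _ _ _ c,
    show galCyclotomeCohomologyMap β 2 (twoCocycleClass _ _) = _ from map_twoCocycleClass _ _ _ _]
  congr 1
  refine Subtype.ext (ContinuousMap.ext fun p => ?_)
  obtain ⟨σ, τ⟩ := p
  rw [contTwoCocycles.pullback_apply, contTwoCocycles.pullback_apply, contTwoCocycles.pullback_apply]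
  change MuZhatMod.congrL (α.trans β) (c.1 ((α.trans β).symm σ, (α.trans β).symm τ)) =
    MuZhatMod.congrL β (MuZhatMod.congrL α (c.1 (α.symm (β.symm σ), α.symm (β.symm τ))))
  rw [Cor110iiPrime.congrL_trans]
  rfl

/-- `H²(α; μ_Ẑ(α))` only depends on the underlying map of `α`. [cite: MochizukiAbsTopIII2015, Cor 1.10 (i) p.42] -/
theorem galCyclotomeH2Map_congr {α α' : G ≃ₜ* G'} (h : ∀ g, α g = α' g) (x : galCyclotomeH2 G) :
    galCyclotomeCohomologyMap α 2 x = galCyclotomeCohomologyMap α' 2 x := by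
  have : α = α' := ContinuousMulEquiv.ext h
  subst this
  rfl

end Trans

/-! ### Chart independence of THE residue isomorphism -/

section Chart

variable {G : Type} [Group G] [TopologicalSpace G] [IsTopologicalGroup G] [CompactSpace G]
  {k₁ k₂ : Type} [Field k₁] [ValuativeRel k₁] [TopologicalSpace k₁] [IsNonarchimedeanLocalField k₁]
  [CharZero k₁] [Field k₂] [ValuativeRel k₂] [TopologicalSpace k₂] [IsNonarchimedeanLocalField k₂] [CharZero k₂]

/-- **THE residue `H²(G, μ_Ẑ(G)) → Ẑ` of an abstract topological group of MLF type does not depend on the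
chart.**  For a topological group `G` and ANY two isomorphisms `ι₁ : G ≃ₜ* G_{k₁}`, `ι₂ : G ≃ₜ* G_{k₂}` onto
absolute Galois groups of MLFs, reading the residue of `x ∈ H²(G, μ_Ẑ(G))` through `ι₁` (transport to
`G_{k₁}`, then `r_{k₁}`) or through `ι₂` gives the same element of `Ẑ` — the «natural isomorphism
`H²(G_k, μ_Ẑ(G_k)) ⥲ Ẑ` constructed "group-theoretically" from `G_k`» (p. 42) is literally a function of the
topological group (Rmk. 1.9.8).  From `residueIso_natural` at `α := ι₁⁻¹ ≫ ι₂` and functoriality.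
[cite: MochizukiAbsTopIII2015, Cor 1.10 (i) p.42] -/
theorem residueIso_chart_independent (ι₁ : G ≃ₜ* absoluteGaloisGroup k₁) (ι₂ : G ≃ₜ* absoluteGaloisGroup k₂)
    (x : galCyclotomeH2 G) :
    residueIso k₂ (galCyclotomeCohomologyMap ι₂ 2 x) = residueIso k₁ (galCyclotomeCohomologyMap ι₁ 2 x) := by
  have h : galCyclotomeCohomologyMap ι₂ 2 x =
      galCyclotomeCohomologyMap (ι₁.symm.trans ι₂) 2 (galCyclotomeCohomologyMap ι₁ 2 x) := by
    rw [← galCyclotomeH2Map_trans]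
    exact galCyclotomeH2Map_congr (fun g => by simp) x
  rw [h]
  exact residueIso_natural (ι₁.symm.trans ι₂) _

/-- Levelwise form: through ANY chart, the `ℤ/n`-components of the transported residue are THE invariant maps
of the chart's MLF — so the number read off is chart-independent AND is the class-field-theoretic invariant.
[cite: MochizukiAbsTopIII2015, Cor 1.10 (i) p.42] -/
theorem level_residueIso_chart (ι₁ : G ≃ₜ* absoluteGaloisGroup k₁) (ι₂ : G ≃ₜ* absoluteGaloisGroup k₂)
    (x : galCyclotomeH2 G) (n : ℕ+) :
    invMap k₂ n (cohomologyMap ((muSystem k₂).projHom n) 2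
        ((cohomologyMap (iso k₂).hom 2).hom (galCyclotomeCohomologyMap ι₂ 2 x))) =
      invMap k₁ n (cohomologyMap ((muSystem k₁).projHom n) 2
        ((cohomologyMap (iso k₁).hom 2).hom (galCyclotomeCohomologyMap ι₁ 2 x))) := by
  rw [← level_residueIso, ← level_residueIso, residueIso_chart_independent ι₁ ι₂ x]

end Chart

end Cor110iaNat

end Literature.AnabelianGeometry.AbsoluteAnabelian
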